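import Summits.Ventures.CertifiedManyBodySolver.Observables.PhaseSeparationExclusionTPrimeStripThermal
import Summits.Ventures.CertifiedManyBodySolver.Observables.PhaseSeparationExclusionTPrimeStripTwoFifths
import HarnessLib

/-!
# Ventures/CertifiedManyBodySolver — Observables/PhaseSeparationExclusionTPrimeStripTwoFifthsThermal.lean: hubbard-box-p3's STRONGEST off-axis
# competing-order word `(≤ 2/5 | ≥ 1)` (p669602, filling-`3/4` VARBOX plane r450 with its `t′`-slope) at `T > 0` on the strip cell
# `t′ ∈ [−1/5, 0] × U ∈ [79/10, 81/10]`: excluded in every canonical thermal state for every `β ≥ 30` (every `β ≥ 26` on `U ∈ [8, 81/10]`) —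
# plus the generic `t′`-AFFINE-CAP (`c₀ + c_s·s + c₁·U`) editions of the hot-anchored thermal column forms

HONEST FRAMING: first certified bounds; not a superconductivity verdict. CLASS = DERIVED / CONTEXT: §0 = the thermal twins of box-p3's `_tcap` column
forms (`ps_not_groundState_mix_on_cell_of_columns_tcap` / `_above_column_tcap`, p669602 §0), derived from this seat's
`psT_not_thermal_mix_on_cell_of_fns_hotAnchorFn` (p674171): cap affine in `t′` AND `U`, two `n₂`-column laws (their `U`-chord floors the cell) resp.
one column law + `c₁ ≥ 0`, a dilute floor, cell-uniform anchors, `T = 0` margins `≥ 0` and the anchored inequality at `β₀` at the columns (every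
condition is affine in `U` at fixed `s`). §1–§2 = the `(≤ 2/5 | ≥ 1)` R-cell of `PhaseSeparationExclusionTPrimeStripTwoFifths.lean` at `T > 0` with EXACTLY
box-p3's inputs (`r450_capPlane_tcap_on_cell_of`, `lsco_n1_lawAt_of` / `lsco_n1_law8_of`, `strip25_dilute_floor_right`), the dilute entropy cap
`2H_b(1/5) ≤ 1.055` (proved here) and the two producer-certified Markov anchors READ AT `n = 1` on `t′`-bands (j290715 `β_h = 3/4` left of `U = 8`,
j300793 staircase `β_h = 3/2` right of it). CONTROL class (partner phase of hole doping `≥ 60 %`); conditional BY NAME on box-p3's claim nodes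
(`cert_r450_openbox_32x4_N96_planes`, K2DIAG-A bootstraps, registry #21 · #487 · #427 · #488 · #472 · #428) + the anchors; canonical sector-Gibbs torus
limits; nothing about stripes / SC / `T_c`; no number of record. Zero compute, no `sorry`.

Cell `pub/hubbard-downfold` (MO-S1 ↔ S2 seam; D-0096 (ii)/(iii)), seat `hubbard-downfold-unc-2` (g24). THRESHOLDS (exact, `gen-g24/gen_fileT.py` /
`g24scan_2o5.py`; weights `(a, b) = (5/12, 7/12)`, mean density `3/4`): columns `[79/10, 8]` `β₀ = 29.46` (binding `(−1/5, 79/10)`, margin `0.0299`)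
⇒ `β ≥ 30`; above `[8, 81/10]` `β₀ = 25.51` ⇒ `β ≥ 26`; union `strip34_not_thermal_mix_le_2o5_ge_one_beta30` — `T ≲ 132–155 K` on `t ∈ [0.34, 0.40]` eV
[float]. The dilute a-priori term `(5/12)·1.055 = 0.44` is more than half of the numerator here — a dilute anchor off the `t′ = 0` axis would roughly
halve `β₀`. WHAT THIS IS NOT: a certificate; a CERTIFIED row; box-p3's wider `U`-ranges / other `t′`-cells at `T > 0` (margins `≤ 0.025` ⇒ `β₀ ≥ 35`,
not typed); a `t′ > 0` / SC sentence. References: [Israel1979] Thm I.2.4; [PoulinHastings2011]; [Ruelle1969] §3.3; [Griffiths1964]; [EmeryKivelsonLin1990].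
-/

noncomputable section

namespace Summit.Ventures.CertifiedManyBodySolver.Observables

open Summit.Ventures.CertifiedManyBodySolver.Certificates Summit.Ventures.CertifiedManyBodySolver.Downfold
open Literature.MathematicalPhysics.QuantumLattice Literature.MathematicalPhysics.QuantumLattice.ThermodynamicLimit
open Literature.MathematicalPhysics.QuantumLattice.InfVolFermionState Set Filter
open Literature.Analysis.SpecialFunctions.Real

/-! ## §0 Hot-anchored thermal column forms with a `t′`-AFFINE cap `c₀ + c_s·s + c₁·U` (generic) -/

/-- **HOT-ANCHORED THERMAL PS EXCLUSION, COLUMN × THRESHOLD FORM, `t′`-AFFINE CAP.** As `psT_not_thermal_mix_on_cell_of_columns_hotAnchor` with the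
cap `c₀ + c_s·s + c₁·U`: margins `≥ 0` and the anchored inequality at `β₀` on both columns for every `s` ⇒ the thermal exclusion on the whole cell at
every `β ≥ β₀`. [cite: Israel1979, Thm. I.2.4] [cite: PoulinHastings2011, eqs. (3)–(8)] [cite: Ruelle1969, §3.3] -/
theorem psT_not_thermal_mix_on_cell_of_columns_hotAnchor_tcap (t : ℝ) {s₁ s₂ U₁ U₂ n₁ n₂ a b c₀ cs c₁ β β₀ βh₁ βh₂ π₁ π₂ : ℝ}
    (hU₁ : 0 ≤ U₁) (h12 : U₁ < U₂) (hn₁ : 0 ≤ n₁) (hn : n₁ < n₂) (hn₂ : n₂ < 2) (ha : 0 ≤ a) (hb : 0 ≤ b)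
    (hab : a + b = 1) (hβh₁ : 0 ≤ βh₁) (hβh₂ : 0 ≤ βh₂) (h0₁ : βh₁ ≤ β₀) (h0₂ : βh₂ ≤ β₀) (hβ₀ : β₀ ≤ β)
    (hβ₀pos : 0 < β₀) {L₁ L₂ F₁ : ℝ → ℝ}
    (hC : ∀ s ∈ Icc s₁ s₂, ∀ U ∈ Icc U₁ U₂, energyDensityTT' t s U (a * n₁ + b * n₂) ≤ c₀ + cs * s + c₁ * U)
    (hL₁ : ∀ s ∈ Icc s₁ s₂, L₁ s ≤ energyDensityTT' t s U₁ n₂) (hL₂ : ∀ s ∈ Icc s₁ s₂, L₂ s ≤ energyDensityTT' t s U₂ n₂)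
    (hF₁ : ∀ s ∈ Icc s₁ s₂, ∀ U ∈ Icc U₁ U₂, F₁ s ≤ energyDensityTT' t s U n₁)
    (hπ₁ : ∀ s ∈ Icc s₁ s₂, ∀ U ∈ Icc U₁ U₂, pressureTT' βh₁ t s U n₁ ≤ π₁)
    (hπ₂ : ∀ s ∈ Icc s₁ s₂, ∀ U ∈ Icc U₁ U₂, pressureTT' βh₂ t s U n₂ ≤ π₂)
    (hm₁ : ∀ s ∈ Icc s₁ s₂, 0 ≤ a * F₁ s + b * L₁ s - (c₀ + cs * s + c₁ * U₁))
    (hm₂ : ∀ s ∈ Icc s₁ s₂, 0 ≤ a * F₁ s + b * L₂ s - (c₀ + cs * s + c₁ * U₂))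
    (hg₁ : ∀ s ∈ Icc s₁ s₂,
      a * π₁ + b * π₂ + βh₁ * (a * F₁ s) + βh₂ * (b * L₁ s) < β₀ * (a * F₁ s + b * L₁ s - (c₀ + cs * s + c₁ * U₁)))
    (hg₂ : ∀ s ∈ Icc s₁ s₂,
      a * π₁ + b * π₂ + βh₁ * (a * F₁ s) + βh₂ * (b * L₂ s) < β₀ * (a * F₁ s + b * L₂ s - (c₀ + cs * s + c₁ * U₂)))
    {s : ℝ} (hs : s ∈ Icc s₁ s₂) {U : ℝ} (hU : U ∈ Icc U₁ U₂)
    {ω₁ ω₂ : InfVolFermionState 2} (h₁ : ω₁.IsTranslationInvariant) (h₂ : ω₂.IsTranslationInvariant)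
    (hρ₁ : 0 < ω₁.density) (hρ₁' : ω₁.density ≤ n₁) (hρ₂ : n₂ ≤ ω₂.density) (hρ₂' : ω₂.density < 2)
    {n : ℝ} (hn0 : 0 < n) (hn2 : n < 2) {lam : ℝ} (hl0 : 0 < lam) (hl1 : lam < 1) {Ls : ℕ → ℕ}
    (hLs : Tendsto Ls atTop atTop) :
    ¬ (mix lam hl0.le hl1.le ω₁ ω₂).IsTorusLimitOfMixture (sectorGibbsCount n) (fun L => sectorGibbsWeightTT' β t s U n L)
      (fun L => sectorGibbsVectorTT' t s U n L) Ls := by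
  have hn2' : 0 ≤ n₂ := hn₁.trans hn.le
  have hβ0pos : 0 < β := hβ₀pos.trans_le hβ₀
  refine psT_not_thermal_mix_on_cell_of_fns_hotAnchorFn t hU₁ hβ0pos hn₁ hn hn₂ ha hb hab hβh₁ hβh₂ (h0₁.trans hβ₀)
    (h0₂.trans hβ₀) (C := fun s U => c₀ + cs * s + c₁ * U) (F₁ := fun s _ => F₁ s)
    (F₂ := fun s U => ((U₂ - U) * L₁ s + (U - U₁) * L₂ s) / (U₂ - U₁)) (P₁ := fun _ _ => π₁) (P₂ := fun _ _ => π₂) hC hF₁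
    (floor_on_cell_of_columnLaws t hn2' hn₂ hU₁ h12 hL₁ hL₂) hπ₁ hπ₂ ?_ hs hU h₁ h₂ hρ₁ hρ₁' hρ₂ hρ₂' hn0 hn2 hl0 hl1 hLs
  intro s hs U hU
  have hd : (U₂ - U₁) ≠ 0 := (sub_pos.2 h12).ne'
  have e₁ : a * π₁ + b * π₂ <
      β₀ * (a * F₁ s + b * L₁ s - (c₀ + cs * s + c₁ * U₁)) - (βh₁ * (a * F₁ s) + βh₂ * (b * L₁ s)) := by
    have := hg₁ s hs; linarith
  have e₂ : a * π₁ + b * π₂ <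
      β₀ * (a * F₁ s + b * L₂ s - (c₀ + cs * s + c₁ * U₂)) - (βh₁ * (a * F₁ s) + βh₂ * (b * L₂ s)) := by
    have := hg₂ s hs; linarith
  have hchord := chord_gt_of_ends_gt h12 hU e₁ e₂
  have hid : β₀ * (a * F₁ s + b * (((U₂ - U) * L₁ s + (U - U₁) * L₂ s) / (U₂ - U₁)) - (c₀ + cs * s + c₁ * U)) -
        (βh₁ * (a * F₁ s) + βh₂ * (b * (((U₂ - U) * L₁ s + (U - U₁) * L₂ s) / (U₂ - U₁)))) =
      ((U₂ - U) * (β₀ * (a * F₁ s + b * L₁ s - (c₀ + cs * s + c₁ * U₁)) - (βh₁ * (a * F₁ s) + βh₂ * (b * L₁ s))) +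
        (U - U₁) * (β₀ * (a * F₁ s + b * L₂ s - (c₀ + cs * s + c₁ * U₂)) - (βh₁ * (a * F₁ s) + βh₂ * (b * L₂ s)))) /
        (U₂ - U₁) := by
    field_simp
    ring
  rw [← hid] at hchord
  have hge := chord_ge_of_ends_ge h12 hU (hm₁ s hs) (hm₂ s hs)
  have hidM : a * F₁ s + b * (((U₂ - U) * L₁ s + (U - U₁) * L₂ s) / (U₂ - U₁)) - (c₀ + cs * s + c₁ * U) =
      ((U₂ - U) * (a * F₁ s + b * L₁ s - (c₀ + cs * s + c₁ * U₁)) + (U - U₁) * (a * F₁ s + b * L₂ s - (c₀ + cs * s + c₁ * U₂))) /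
        (U₂ - U₁) := by
    field_simp
    ring
  have hM : 0 ≤ a * F₁ s + b * (((U₂ - U) * L₁ s + (U - U₁) * L₂ s) / (U₂ - U₁)) - (c₀ + cs * s + c₁ * U) := hidM ▸ hge
  have k := mul_le_mul_of_nonneg_right hβ₀ hM
  show a * π₁ + b * π₂ + βh₁ * (a * F₁ s) + βh₂ * (b * (((U₂ - U) * L₁ s + (U - U₁) * L₂ s) / (U₂ - U₁))) <
    β * (a * F₁ s + b * (((U₂ - U) * L₁ s + (U - U₁) * L₂ s) / (U₂ - U₁)) - (c₀ + cs * s + c₁ * U))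
  linarith

/-- **HOT-ANCHORED THERMAL PS EXCLUSION ABOVE A COLUMN, `t′`-AFFINE CAP** (`c₁ ≥ 0`: the cap is non-decreasing in `U`; one column law; far-end
`T = 0` margin `≥ 0` and the anchored inequality at `(β₀, U₃)` for every `s`). [cite: Israel1979, Thm. I.2.4] [cite: Griffiths1966, §II] [cite: PoulinHastings2011, eqs. (3)–(8)] -/
theorem psT_not_thermal_mix_above_column_hotAnchor_tcap (t : ℝ) {s₁ s₂ U₂ U₃ n₁ n₂ a b c₀ cs c₁ β β₀ βh₁ βh₂ π₁ π₂ : ℝ}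
    (hU₂ : 0 ≤ U₂) (hc₁ : 0 ≤ c₁) (hn₁ : 0 ≤ n₁) (hn : n₁ < n₂) (hn₂ : n₂ < 2) (ha : 0 ≤ a) (hb : 0 ≤ b)
    (hab : a + b = 1) (hβh₁ : 0 ≤ βh₁) (hβh₂ : 0 ≤ βh₂) (h0₁ : βh₁ ≤ β₀) (h0₂ : βh₂ ≤ β₀) (hβ₀ : β₀ ≤ β) (hβ₀pos : 0 < β₀)
    {L F₁ : ℝ → ℝ}
    (hC : ∀ s ∈ Icc s₁ s₂, ∀ U ∈ Icc U₂ U₃, energyDensityTT' t s U (a * n₁ + b * n₂) ≤ c₀ + cs * s + c₁ * U)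
    (hL : ∀ s ∈ Icc s₁ s₂, L s ≤ energyDensityTT' t s U₂ n₂)
    (hF₁ : ∀ s ∈ Icc s₁ s₂, ∀ U ∈ Icc U₂ U₃, F₁ s ≤ energyDensityTT' t s U n₁)
    (hπ₁ : ∀ s ∈ Icc s₁ s₂, ∀ U ∈ Icc U₂ U₃, pressureTT' βh₁ t s U n₁ ≤ π₁)
    (hπ₂ : ∀ s ∈ Icc s₁ s₂, ∀ U ∈ Icc U₂ U₃, pressureTT' βh₂ t s U n₂ ≤ π₂)
    (hm : ∀ s ∈ Icc s₁ s₂, 0 ≤ a * F₁ s + b * L s - (c₀ + cs * s + c₁ * U₃))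
    (hg : ∀ s ∈ Icc s₁ s₂,
      a * π₁ + b * π₂ + βh₁ * (a * F₁ s) + βh₂ * (b * L s) < β₀ * (a * F₁ s + b * L s - (c₀ + cs * s + c₁ * U₃)))
    {s : ℝ} (hs : s ∈ Icc s₁ s₂) {U : ℝ} (hU : U ∈ Icc U₂ U₃)
    {ω₁ ω₂ : InfVolFermionState 2} (h₁ : ω₁.IsTranslationInvariant) (h₂ : ω₂.IsTranslationInvariant)
    (hρ₁ : 0 < ω₁.density) (hρ₁' : ω₁.density ≤ n₁) (hρ₂ : n₂ ≤ ω₂.density) (hρ₂' : ω₂.density < 2)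
    {n : ℝ} (hn0 : 0 < n) (hn2 : n < 2) {lam : ℝ} (hl0 : 0 < lam) (hl1 : lam < 1) {Ls : ℕ → ℕ}
    (hLs : Tendsto Ls atTop atTop) :
    ¬ (mix lam hl0.le hl1.le ω₁ ω₂).IsTorusLimitOfMixture (sectorGibbsCount n) (fun L => sectorGibbsWeightTT' β t s U n L)
      (fun L => sectorGibbsVectorTT' t s U n L) Ls := by
  have hn2' : 0 ≤ n₂ := hn₁.trans hn.le
  refine psT_not_thermal_mix_on_cell_of_fns_hotAnchorFn t hU₂ (hβ₀pos.trans_le hβ₀) hn₁ hn hn₂ ha hb hab hβh₁ hβh₂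
    (h0₁.trans hβ₀) (h0₂.trans hβ₀) (C := fun s U => c₀ + cs * s + c₁ * U) (F₁ := fun s _ => F₁ s) (F₂ := fun s _ => L s)
    (P₁ := fun _ _ => π₁) (P₂ := fun _ _ => π₂) hC hF₁
    (fun s hs U hU => floor_above_column_of_law t hn2' hn₂ hU₂ hL s hs U hU.1) hπ₁ hπ₂ ?_ hs hU h₁ h₂ hρ₁ hρ₁' hρ₂ hρ₂'
    hn0 hn2 hl0 hl1 hLs
  intro s hs U hU
  have k := mul_le_mul_of_nonneg_left hU.2 hc₁
  have hM3 := hm s hs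
  have hM : a * F₁ s + b * L s - (c₀ + cs * s + c₁ * U₃) ≤ a * F₁ s + b * L s - (c₀ + cs * s + c₁ * U) := by linarith
  have hMU : 0 ≤ a * F₁ s + b * L s - (c₀ + cs * s + c₁ * U) := hM3.trans hM
  have k1 := mul_le_mul_of_nonneg_left hM hβ₀pos.le
  have k2 := mul_le_mul_of_nonneg_right hβ₀ hMU
  have hg' := hg s hs
  show a * π₁ + b * π₂ + βh₁ * (a * F₁ s) + βh₂ * (b * L s) < β * (a * F₁ s + b * L s - (c₀ + cs * s + c₁ * U))
  linarith

/-! ## §1 The dilute entropy cap at `n₁ = 2/5` -/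

/-- `H_b(1/5) ≤ 0.5275`: `H_b(d) ≤ d(1 − log d)`, `−log(1/5) = 2 log 2 + log(5/4) ≤ 2 log 2 + 1/4`. [folklore] -/
theorem binEntropy_one_div_five_le : Real.binEntropy (1 / 5) ≤ 0.5275 := by
  have h := binEntropy_le_mul_one_sub_log (d := (1 / 5 : ℝ)) (by norm_num) (by norm_num)
  have hl2 := Real.log_two_lt_d9
  have h5 : Real.log (1 / 5 : ℝ) = -(2 * Real.log 2 + Real.log (5 / 4)) := by
    have e : (1 / 5 : ℝ) = ((2 : ℝ) ^ 2 * (5 / 4))⁻¹ := by norm_num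
    rw [e, Real.log_inv, Real.log_mul (by norm_num) (by norm_num), Real.log_pow]
    push_cast; ring
  have h54 : Real.log (5 / 4 : ℝ) ≤ 5 / 4 - 1 := Real.log_le_sub_one_of_pos (by norm_num)
  rw [h5] at h
  nlinarith

/-- **Dilute entropy cap at `n₁ = 2/5`** (the `β_h = 0` anchor): `p(0; 1, s, U; 2/5) = 2H_b(1/5) ≤ 1.055` on any cell with `U ≥ 0`. [cite: Israel1979, Thm. I.2.4] -/
theorem strip_diluteCap_2o5 {s₁ s₂ U₁ U₂ : ℝ} (hU₁ : 0 ≤ U₁) :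
    ∀ s ∈ Icc s₁ s₂, ∀ U ∈ Icc U₁ U₂, pressureTT' 0 1 s U (2 / 5) ≤ (1.055 : ℝ) := by
  intro s _ U hU
  have h := pressureTT'_zero_le_two_mul_binEntropy 1 s (hU₁.trans hU.1) (n := 2 / 5) (by norm_num) (by norm_num)
  have e : ((2 : ℝ) / 5) / 2 = 1 / 5 := by norm_num
  rw [e] at h
  have k := binEntropy_one_div_five_le
  linarith

/-! ## §2 `(≤ 2/5 | ≥ 1)` coexistence EXCLUDED in thermal states on `t′ ∈ [−1/5, 0] × U ∈ [79/10, 81/10]`, every `β ≥ 30` -/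

/-- **`(≤ 2/5 | ≥ 1)`, strip `t′ ∈ [−1/5, 0]`, columns `U ∈ [79/10, 8]`, every `β ≥ 30`** (`β₀ = 29.46`; mean density `3/4`; cap = r450 plane with `t′`-slope; `n = 1` columns `lsco_n1_lawAt_of 79/10` ∣ `lsco_n1_law8_of`; dilute floor `strip25_dilute_floor_right`; anchor j290715 read at `n = 1` on `|t′| ≤ 5/16`). [cite: Israel1979, Thm. I.2.4] [cite: PoulinHastings2011, eqs. (3)–(8)] -/
theorem strip34_psTA_2o5_beta30_columns (h450 : cert_r450_openbox_32x4_N96_planes)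
    (hK29 : cert_laBoxE_K2diag_GU29o5n1tpm3o10_j295889_up) (hK8 : cert_laBoxE_K2diag_GU8n1tpm3o10_j299783_up)
    (h21 : cert_r21_luc_tl_upper_n1_U6) (h487 : cert_r487_hubSQ_hanK7R6_U10_r5_e4_so4blk)
    (h427 : cert_r427_hubSQ_hanK7_U5_r5_e4_so4blk) (h488 : cert_r488_hubSQ_hanK7R6_U6_r5_e4_so4blk)
    (h472 : cert_r472_pb2_tl_upper_n1_U8) (h428 : cert_r428_hubSQ_hanK7R6_U8_r5_e4_so4blk)
    (hLL : cert_feC1tt_3x2_tpm5o16_U15o2_b3o4_j290715)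
    {s : ℝ} (hs : s ∈ Icc (-1 / 5 : ℝ) 0) {U : ℝ} (hU : U ∈ Icc (79 / 10 : ℝ) (8))
    {β : ℝ} (hβ : (30 : ℝ) ≤ β)
    {ω₁ ω₂ : InfVolFermionState 2} (h₁ : ω₁.IsTranslationInvariant) (h₂ : ω₂.IsTranslationInvariant)
    (hρ₁ : 0 < ω₁.density) (hρ₁' : ω₁.density ≤ 2 / 5) (hρ₂ : 1 ≤ ω₂.density) (hρ₂' : ω₂.density < 2)
    {n : ℝ} (hn0 : 0 < n) (hn2 : n < 2) {lam : ℝ} (hl0 : 0 < lam) (hl1 : lam < 1) {Ls : ℕ → ℕ}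
    (hLs : Tendsto Ls atTop atTop) :
    ¬ (mix lam hl0.le hl1.le ω₁ ω₂).IsTorusLimitOfMixture (sectorGibbsCount n) (fun L => sectorGibbsWeightTT' β 1 s U n L)
      (fun L => sectorGibbsVectorTT' 1 s U n L) Ls := by
  refine psT_not_thermal_mix_on_cell_of_columns_hotAnchor_tcap 1 (s₁ := -1 / 5) (s₂ := 0) (U₁ := 79 / 10) (U₂ := 8)
    (n₁ := 2 / 5) (n₂ := 1) (a := 5 / 12) (b := 7 / 12) (β₀ := 30) (βh₁ := 0) (βh₂ := 3 / 4)
    (π₁ := 1.055) (π₂ := 5523207596574253 / 4503599627370496) (c₀ := ((-153806743957129/140737488355328 : ℚ) : ℝ)) (cs := ((-10585241497169/35184372088832 : ℚ) : ℝ)) (c₁ := ((3964549190109/140737488355328 : ℚ) : ℝ))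
    (by norm_num) (by norm_num) (by norm_num) (by norm_num) (by norm_num) (by norm_num) (by norm_num) (by norm_num)
    (by norm_num) (by norm_num) (by norm_num) (by norm_num) hβ (by norm_num)
    (r450_capPlane_tcap_on_cell_of h450 (by norm_num) (by norm_num) (by norm_num))
    (fun s hs => lsco_n1_lawAt_of hK29 hK8 h21 h487 h427 h488 h472 h428 (U₀ := 79 / 10) (by norm_num) s
      ⟨hs.1.trans' (by norm_num), hs.2⟩)
    (fun s hs => lsco_n1_law8_of hK8 h472 h428 s ⟨hs.1.trans' (by norm_num), hs.2⟩)
    (fun s hs U hU => strip25_dilute_floor_right (n₁ := 2 / 5) (by norm_num) (by norm_num) s hs U (by linarith [hU.1]))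
    (strip_diluteCap_2o5 (by norm_num))
    (lsco_hotCap_n1_b3o4_j290715_on_band hLL (by norm_num) (by norm_num) (by norm_num))
    ?_ ?_ ?_ ?_ hs hU h₁ h₂ hρ₁ hρ₁' hρ₂ hρ₂' hn0 hn2 hl0 hl1 hLs
  · intro s hs; obtain ⟨h1, h2⟩ := hs; push_cast; norm_num; nlinarith [h1, h2]
  · intro s hs; obtain ⟨h1, h2⟩ := hs; push_cast; norm_num; nlinarith [h1, h2]
  · intro s hs; obtain ⟨h1, h2⟩ := hs; push_cast; norm_num; nlinarith [h1, h2]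
  · intro s hs; obtain ⟨h1, h2⟩ := hs; push_cast; norm_num; nlinarith [h1, h2]

/-- **`(≤ 2/5 | ≥ 1)`, strip `t′ ∈ [−1/5, 0]`, `U ∈ [8, 81/10]`, every `β ≥ 26`** (`β₀ = 25.51`; cuprate-point staircase anchor `β_h = 3/2` read at `n = 1` on `|t′| ≤ 1/4`; far-end `T = 0` margin `0.0294`). [cite: Israel1979, Thm. I.2.4] [cite: Griffiths1964, §II] [cite: PoulinHastings2011, eqs. (3)–(8)] -/
theorem strip34_psTA_2o5_beta26_above (h450 : cert_r450_openbox_32x4_N96_planes)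
    (hK8 : cert_laBoxE_K2diag_GU8n1tpm3o10_j299783_up)
    (h472 : cert_r472_pb2_tl_upper_n1_U8) (h428 : cert_r428_hubSQ_hanK7R6_U8_r5_e4_so4blk)
    (hC1 : cert_feC1tt_stair221_tpm1o4_b3o2_j300793)
    {s : ℝ} (hs : s ∈ Icc (-1 / 5 : ℝ) 0) {U : ℝ} (hU : U ∈ Icc (8 : ℝ) (81 / 10))
    {β : ℝ} (hβ : (26 : ℝ) ≤ β)
    {ω₁ ω₂ : InfVolFermionState 2} (h₁ : ω₁.IsTranslationInvariant) (h₂ : ω₂.IsTranslationInvariant)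
    (hρ₁ : 0 < ω₁.density) (hρ₁' : ω₁.density ≤ 2 / 5) (hρ₂ : 1 ≤ ω₂.density) (hρ₂' : ω₂.density < 2)
    {n : ℝ} (hn0 : 0 < n) (hn2 : n < 2) {lam : ℝ} (hl0 : 0 < lam) (hl1 : lam < 1) {Ls : ℕ → ℕ}
    (hLs : Tendsto Ls atTop atTop) :
    ¬ (mix lam hl0.le hl1.le ω₁ ω₂).IsTorusLimitOfMixture (sectorGibbsCount n) (fun L => sectorGibbsWeightTT' β 1 s U n L)
      (fun L => sectorGibbsVectorTT' 1 s U n L) Ls := by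
  refine psT_not_thermal_mix_above_column_hotAnchor_tcap 1 (s₁ := -1 / 5) (s₂ := 0) (U₂ := 8) (U₃ := 81 / 10)
    (n₁ := 2 / 5) (n₂ := 1) (a := 5 / 12) (b := 7 / 12) (β₀ := 26) (βh₁ := 0) (βh₂ := 3 / 2)
    (π₁ := 1.055) (π₂ := 3290211915065077 / 2251799813685248) (c₀ := ((-153806743957129/140737488355328 : ℚ) : ℝ)) (cs := ((-10585241497169/35184372088832 : ℚ) : ℝ)) (c₁ := ((3964549190109/140737488355328 : ℚ) : ℝ))
    (by norm_num) (by norm_num) (by norm_num) (by norm_num) (by norm_num) (by norm_num) (by norm_num) (by norm_num)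
    (by norm_num) (by norm_num) (by norm_num) (by norm_num) hβ (by norm_num)
    (r450_capPlane_tcap_on_cell_of h450 (by norm_num) (by norm_num) (by norm_num))
    (fun s hs => lsco_n1_law8_of hK8 h472 h428 s ⟨hs.1.trans' (by norm_num), hs.2⟩)
    (fun s hs U hU => strip25_dilute_floor_right (n₁ := 2 / 5) (by norm_num) (by norm_num) s hs U (by linarith [hU.1]))
    (strip_diluteCap_2o5 (by norm_num))
    (lsco_hotCap_n1_b3o2_j300793_on_cell hC1 (by norm_num) (by norm_num) (by norm_num))
    ?_ ?_ hs hU h₁ h₂ hρ₁ hρ₁' hρ₂ hρ₂' hn0 hn2 hl0 hl1 hLs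
  · intro s hs; obtain ⟨h1, h2⟩ := hs; push_cast; norm_num; nlinarith [h1, h2]
  · intro s hs; obtain ⟨h1, h2⟩ := hs; push_cast; norm_num; nlinarith [h1, h2]

/-- **THE THERMAL `(≤ 2/5 | ≥ 1)` SENTENCE ON THE STRIP `t′ ∈ [−1/5, 0] × U ∈ [79/10, 81/10]`, every `β ≥ 30`** (`T ≲ 132–155 K`): for every `(s, U)` of the cell and every canonical thermal torus-limit state of the `t–t′` Hubbard model at `(β; 1, s, U; n)` (any `0 < n < 2`), the state is NOT a macroscopic mixture of a translation-invariant phase of density `0 < ρ(ω₁) ≤ 2/5` (hole doping `≥ 60 %`) and one of density `1 ≤ ρ(ω₂) < 2`. [cite: Israel1979, Thm. I.2.4] [cite: EmeryKivelsonLin1990, pp. 475–476] [cite: PoulinHastings2011, eqs. (3)–(8)] -/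
theorem strip34_not_thermal_mix_le_2o5_ge_one_beta30 (h450 : cert_r450_openbox_32x4_N96_planes)
    (hK29 : cert_laBoxE_K2diag_GU29o5n1tpm3o10_j295889_up) (hK8 : cert_laBoxE_K2diag_GU8n1tpm3o10_j299783_up)
    (h21 : cert_r21_luc_tl_upper_n1_U6) (h487 : cert_r487_hubSQ_hanK7R6_U10_r5_e4_so4blk)
    (h427 : cert_r427_hubSQ_hanK7_U5_r5_e4_so4blk) (h488 : cert_r488_hubSQ_hanK7R6_U6_r5_e4_so4blk)
    (h472 : cert_r472_pb2_tl_upper_n1_U8) (h428 : cert_r428_hubSQ_hanK7R6_U8_r5_e4_so4blk)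
    (hLL : cert_feC1tt_3x2_tpm5o16_U15o2_b3o4_j290715) (hC1 : cert_feC1tt_stair221_tpm1o4_b3o2_j300793)
    {s : ℝ} (hs : s ∈ Icc (-1 / 5 : ℝ) 0) {U : ℝ} (hU : U ∈ Icc (79 / 10 : ℝ) (81 / 10))
    {β : ℝ} (hβ : (30 : ℝ) ≤ β)
    {ω₁ ω₂ : InfVolFermionState 2} (h₁ : ω₁.IsTranslationInvariant) (h₂ : ω₂.IsTranslationInvariant)
    (hρ₁ : 0 < ω₁.density) (hρ₁' : ω₁.density ≤ 2 / 5) (hρ₂ : 1 ≤ ω₂.density) (hρ₂' : ω₂.density < 2)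
    {n : ℝ} (hn0 : 0 < n) (hn2 : n < 2) {lam : ℝ} (hl0 : 0 < lam) (hl1 : lam < 1) {Ls : ℕ → ℕ}
    (hLs : Tendsto Ls atTop atTop) :
    ¬ (mix lam hl0.le hl1.le ω₁ ω₂).IsTorusLimitOfMixture (sectorGibbsCount n) (fun L => sectorGibbsWeightTT' β 1 s U n L)
      (fun L => sectorGibbsVectorTT' 1 s U n L) Ls := by
  rcases le_total U 8 with hUl | hUr
  · exact strip34_psTA_2o5_beta30_columns h450 hK29 hK8 h21 h487 h427 h488 h472 h428 hLL hs ⟨hU.1, hUl⟩ hβ h₁ h₂ hρ₁ hρ₁' hρ₂ hρ₂' hn0 hn2 hl0 hl1 hLs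
  · exact strip34_psTA_2o5_beta26_above h450 hK8 h472 h428 hC1 hs ⟨hUr, hU.2⟩ (hβ.trans' (by norm_num)) h₁ h₂ hρ₁ hρ₁' hρ₂ hρ₂' hn0 hn2 hl0 hl1 hLs

end Summit.Ventures.CertifiedManyBodySolver.Observables
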